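import Summits.AtomisticToContinuum.FouriersLaw.Theorems.BondHeatUncertaintyExtensiveSnapshotIrreversibilityEnergyWindowCostateFloor
import Summits.AtomisticToContinuum.FouriersLaw.Theorems.BondHeatUncertaintyExtensiveSnapshotIrreversibilityEnergyWindowCostateAt
import HarnessLib

/-!
# Bond heat uncertainty — energy window: the costate sampling floor (CSF) — PROVED

Cell `decomp-a2c`, lens-1 «grading / quantitative ladder», generation 84, crux
`stmt-AtomisticToContinuum-9121` (`ExtensiveSnapshotIrreversibility`, K_fix half, leaf S3), part K.
Part J split the measure-free floor (EBF) as (EBF) ⟸ (CSF) ∧ (COF).  This file PROVES (CSF)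
`CostateSamplingFloor` for the anharmonic chain (every `ω₂ > 0`, `lam, β, γ ≥ 0`, every `N ≥ 2`,
`0 < s ≤ 1`), so that the record beneath the binder of record collapses to ONE deterministic leaf:

  (MC∞) `SkeletonGramLimitInverseMoments` ⟸ (COF) `CostateObservabilityFloor`
  (`skeletonGramLimitInverseMoments_of_costateObservabilityFloor`, §3).

The proof is the anharmonic replica of parts `…GramSampling` §3 / `…SkeletonGramFloor` §4 with the
PATH COSTATE in place of the closed-form harmonic costate:
* §1 `skelGramForm_ge_inl` — for any continuous `f`, `B`-bounded and `Lip`-Lipschitz on `[0, s]`,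
  whose cell means are the left-bath pairings of a direction `a`
  (`⟨λ_a, D E^s(x)[b_{inl k}]⟩ = amp 2^m ∫_cell f`), the Gram form obeys
  `amp² (½ ∫₀ˢ f² - 2^{-m} (B² + s Lip²)) ≤ aᵀ Γ_m a` (tree `dotProduct_skelGramAt_mulVec`,
  `sum_sq_cellIntegral_ge`);
* §2 `dualPair_costate_skelCell_inl` — for a global costate along the path the left-bath pairings
  ARE the cell means of `β_0` with `amp = ampL = √(2γT_L)` (tree W-7a `dualPair_costate_at_tent`,
  `fderiv_skelFlowMapAt_apply`, `pinnedChainVariation_eq_solMap`); `costate_bounds` — Grönwall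
  along the path: `sup_{[0,s]} ‖c‖ ≤ ‖c(s)‖ e^{Gs}` and `Lip(c) ≤ G ‖c(s)‖ e^{Gs}` with
  `G = sup_{[0,s]} ‖𝒢(ζ_r)‖` (a PATHWISE constant, uniform in the direction);
* §3 the assembly: with the costate `c` of terminal value `λ_a` (tree
  `exists_linearODE_solution_of_continuous`) the frame hypothesis of (CSF) gives
  `ampL² ∫₀ˢ β_0² ≥ η |a|²`, hence `F_m ≥ η/2 - 2^{-m} C_E(z, wp)` for every level and
  `L = sup_m F_m⁺ ≥ η/2` (`le_of_tendsto'`).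
No instance / notation / option; no proof holes.  References: the tree files above;
(after Nualart2006, §2.3); [cite: CuneoEckmannHairerReyBellet2018, Prop 4.1]. [folklore]
-/

noncomputable section

namespace Summit.AtomisticToContinuum.FouriersLaw.Theorems.ExtensiveSnapshotIrreversibility.EnergyWindow

open MeasureTheory Filter Topology Set
open scoped ENNReal NNReal Matrix
open Literature.MathematicalPhysics.KineticTheory.HeatConduction Literature.Probability.Process

section Sampling

variable {ω₂ lam β γ : ℝ} (hω : 0 < ω₂) (hl : 0 ≤ lam) (hβ : 0 ≤ β) (hγ : 0 ≤ γ) {N : ℕ}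
  (hN : 0 < N) (T_L T_R : ℝ)

/-! ## 1. The Gram form dominates the sampled observation energy of any cell profile -/

/-- **Gram form versus Riemann sums.**  If the left-bath pairings of the direction `a` at level
`m` are the cell means `amp 2^m ∫_cell f` of a continuous `f`, `B`-bounded and `Lip`-Lipschitz on
`[0, s]` (`0 < s ≤ 1`), then `amp² (½ ∫₀ˢ f² - 2^{-m} (B² + s Lip²)) ≤ aᵀ Γ_m(z, wp) a`.
[folklore] -/
theorem skelGramForm_ge_inl (m : ℕ) (z : PhaseSpace N) (wp : WienerPair) {s : ℝ} (hs0 : 0 < s)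
    (hs1 : s ≤ 1) (a : Fin N ⊕ Fin N → ℝ) {f : ℝ → ℝ} (hf : Continuous f) {Lip B amp : ℝ}
    (hLip0 : 0 ≤ Lip) (hL : ∀ t ∈ Icc 0 s, ∀ u ∈ Icc 0 s, |f t - f u| ≤ Lip * |t - u|)
    (hB : ∀ t ∈ Icc 0 s, |f t| ≤ B)
    (hcell : ∀ k : Fin (2 ^ m), rnode m (k + 1) ≤ s →
      dualPair (ofCoordV N a) (fderiv ℝ (skelFlowMapAt ω₂ lam β γ N T_L T_R s m z (pairRem m wp))
        (pairSkel m wp) (basisX m (Sum.inl k))) =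
          amp * 2 ^ m * ∫ t in rnode m k..rnode m (k + 1), f t) :
    amp ^ 2 * ((1 / 2) * (∫ t in (0 : ℝ)..s, f t ^ 2) - ((2 : ℝ) ^ m)⁻¹ * (B ^ 2 + s * Lip ^ 2)) ≤
      a ⬝ᵥ (skelGramPath ω₂ lam β γ N T_L T_R s m z wp *ᵥ a) := by
  rw [skelGramPath_eq, dotProduct_skelGramAt_mulVec, Fintype.sum_sum_type]
  have hR := sum_sq_cellIntegral_ge hf hs0.le hLip0 hL hB m
  refine (mul_le_mul_of_nonneg_left hR (sq_nonneg amp)).trans ?_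
  -- compare the `ℕ`-indexed Riemann sum with the `Fin`-indexed Gram sum over the `inl` cells
  set K := Nat.floor (s * 2 ^ m) with hK
  have hKle : K ≤ 2 ^ m := floor_mul_two_pow_le hs0.le hs1 m
  set W : Fin (2 ^ m) → ℝ := fun k => (dualPair (ofCoordV N a)
    (fderiv ℝ (skelFlowMapAt ω₂ lam β γ N T_L T_R s m z (pairRem m wp)) (pairSkel m wp)
      (basisX m (Sum.inl k)))) ^ 2 with hW
  set F : ℕ → ℝ := fun i => if h : i < 2 ^ m then ((2 : ℝ) ^ m)⁻¹ * W ⟨i, h⟩ else 0 with hF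
  have hF0 : ∀ i, 0 ≤ F i := by
    intro i
    simp only [hF]
    split_ifs
    · exact mul_nonneg (by positivity) (sq_nonneg _)
    · exact le_rfl
  have hFW : ∑ k : Fin (2 ^ m), ((2 : ℝ) ^ m)⁻¹ * W k = ∑ i ∈ Finset.range (2 ^ m), F i := by
    rw [← Fin.sum_univ_eq_sum_range]
    refine Finset.sum_congr rfl fun k _ => ?_
    simp only [hF, dif_pos k.isLt]
  have hFG : ∀ i ∈ Finset.range K,
      amp ^ 2 * (2 ^ m * (∫ t in rnode m i..rnode m (i + 1), f t) ^ 2) = F i := by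
    intro i hi
    rw [Finset.mem_range] at hi
    have hi2 : i < 2 ^ m := lt_of_lt_of_le hi hKle
    have hks : rnode m (i + 1) ≤ s := rnode_succ_le_of_lt_floor hs0.le m hi
    simp only [hF, dif_pos hi2, hW, hcell ⟨i, hi2⟩ hks]
    field_simp
  calc amp ^ 2 * ∑ k ∈ Finset.range K, 2 ^ m * (∫ t in rnode m k..rnode m (k + 1), f t) ^ 2
      = ∑ i ∈ Finset.range K, F i := by
        rw [Finset.mul_sum]
        exact Finset.sum_congr rfl hFG
    _ ≤ ∑ i ∈ Finset.range (2 ^ m), F i :=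
        Finset.sum_le_sum_of_subset_of_nonneg (Finset.range_mono hKle) fun i _ _ => hF0 i
    _ = ((2 : ℝ) ^ m)⁻¹ * ∑ k : Fin (2 ^ m), W k := by rw [← hFW, Finset.mul_sum]
    _ ≤ ((2 : ℝ) ^ m)⁻¹ * (∑ k : Fin (2 ^ m), W k + ∑ k : Fin (2 ^ m), (dualPair (ofCoordV N a)
          (fderiv ℝ (skelFlowMapAt ω₂ lam β γ N T_L T_R s m z (pairRem m wp)) (pairSkel m wp)
            (basisX m (Sum.inr k)))) ^ 2) :=
        mul_le_mul_of_nonneg_left (le_add_of_nonneg_right (Finset.sum_nonneg fun k _ =>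
          sq_nonneg _)) (by positivity)

include hω hl hβ hγ

/-! ## 2. Path costates: the cell pairings and the Grönwall bounds -/

/-- **Left-bath cell pairing of a path costate.**  For a (global) costate `c` along the driven
path and a left cell `[t_k, t_{k+1}] ⊆ [0, s]`:
`⟨c(s), D E^s(x)[b_{inl k}]⟩ = ampL · 2^m ∫_{t_k}^{t_{k+1}} β_0(u) du` (tree W-7a). [folklore] -/
theorem dualPair_costate_skelCell_inl (m : ℕ) (z : PhaseSpace N) (wp : WienerPair) {s : ℝ}
    (hs : s ∈ Icc (0 : ℝ) 1) {c : ℝ → PhaseSpace N}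
    (hcd : ∀ u, HasDerivAt c ((pinnedChain ω₂ lam β γ).coDrift N
      ((pinnedChain ω₂ lam β γ).solMap N T_L T_R u z (pairPath wp)) (c u)) u)
    (k : Fin (2 ^ m)) (hks : rnode m (k + 1) ≤ s) :
    dualPair (c s) (fderiv ℝ (skelFlowMapAt ω₂ lam β γ N T_L T_R s m z (pairRem m wp))
        (pairSkel m wp) (basisX m (Sum.inl k))) =
      ampL ω₂ lam β γ T_L * 2 ^ m * ∫ u in rnode m k..rnode m (k + 1), (c u).2 ⟨0, hN⟩ := by
  set P := pinnedChain ω₂ lam β γ with hP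
  set ζ : ℝ → PhaseSpace N := fun u => P.solMap N T_L T_R u z (pairPath wp) with hζ
  have hζc : Continuous ζ := pinnedChain_continuous_solMap hω hl hβ hγ N T_L T_R z (pairPath wp)
  have hcc : ContinuousOn c (Icc 0 s) :=
    (continuous_iff_continuousAt.2 fun u => (hcd u).continuousAt).continuousOn
  have hcd' : ∀ u ∈ Ioo (0 : ℝ) s, HasDerivAt c (P.coDrift N (ζ u) (c u)) u := fun u _ => hcd u
  set δ : PairSkeleton m := (Pi.single k 1, 0) with hδ
  have hbasis : basisX m (Sum.inl k) = δ := rfl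
  set W := pinnedChainVariation hω hl hβ hγ N z
    (continuous_chainNoise_rem ω₂ lam β γ N T_L T_R (pairRem m wp))
    (skelForcing N m (ampL ω₂ lam β γ T_L) (ampR ω₂ lam β γ T_R)) (pairSkel m wp) δ with hW
  have hWs : fderiv ℝ (skelFlowMapAt ω₂ lam β γ N T_L T_R s m z (pairRem m wp)) (pairSkel m wp)
      (basisX m (Sum.inl k)) = W s := by
    rw [hbasis, hW]
    exact fderiv_skelFlowMapAt_apply hω hl hβ hγ N T_L T_R hs m z (pairRem m wp) (pairSkel m wp) δ
  have hWeq : ∀ τ ∈ Icc (0 : ℝ) s, W τ = ((0 : Fin N → ℝ), fun i : Fin N =>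
      if i = ⟨0, hN⟩ then ampL ω₂ lam β γ T_L * rtent m k τ else 0) +
      ∫ u in (0 : ℝ)..τ, fderiv ℝ (P.drift N) (ζ u) (W u) := by
    intro τ hτ
    have hτ' : τ ∈ Icc (0 : ℝ) 1 := ⟨hτ.1, hτ.2.trans hs.2⟩
    rw [hW, pinnedChainVariation_eq_solMap hω hl hβ hγ N T_L T_R m z wp δ hτ']
    congr 2
    funext i
    rw [skelForcing_single_fst, tentCoeff_toNN]
    by_cases hi : i = ⟨0, hN⟩
    · subst hi; simp
    · have : i.val ≠ 0 := fun h => hi (Fin.ext h)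
      simp [hi, this]
  rw [hWs]
  exact dualPair_costate_at_tent (pinnedChain_contDiff_U ω₂ lam β γ)
    (pinnedChain_contDiff_V ω₂ lam β γ) hζc
    (continuous_pinnedChainVariation hω hl hβ hγ N z _ _ (pairSkel m wp) δ) hcc hcd' ⟨0, hN⟩
    (ampL ω₂ lam β γ T_L) hks hWeq

omit hN in
/-- **Grönwall along the path.**  There is a PATHWISE constant `G = G(z, wp, s) ≥ 0`
(`sup_{[0,s]} ‖𝒢(ζ_r)‖`) such that every global costate `c` satisfies
`‖c(u)‖ ≤ ‖c(s)‖ e^{Gs}` on `[0, s]` and `‖c(t) - c(u)‖ ≤ G ‖c(s)‖ e^{Gs} |t - u|` on `[0, s]²`.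
[folklore] -/
theorem costate_bounds (z : PhaseSpace N) (wp : WienerPair) (s : ℝ) :
    ∃ G : ℝ, 0 ≤ G ∧ ∀ c : ℝ → PhaseSpace N,
      (∀ u, HasDerivAt c ((pinnedChain ω₂ lam β γ).coDrift N
        ((pinnedChain ω₂ lam β γ).solMap N T_L T_R u z (pairPath wp)) (c u)) u) →
      (∀ u ∈ Icc 0 s, ‖c u‖ ≤ ‖c s‖ * Real.exp (G * s)) ∧
        ∀ t ∈ Icc 0 s, ∀ u ∈ Icc 0 s,
          ‖c t - c u‖ ≤ G * (‖c s‖ * Real.exp (G * s)) * |t - u| := by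
  have hMc : Continuous fun u => coDriftLinear ω₂ lam β γ N
      ((pinnedChain ω₂ lam β γ).solMap N T_L T_R u z (pairPath wp)) :=
    continuous_coDriftLinear_solMap hω hl hβ hγ N T_L T_R z wp
  obtain ⟨C, hC⟩ := isCompact_Icc.exists_bound_of_continuousOn (hMc.continuousOn (s := Icc 0 s))
  refine ⟨max C 0, le_max_right _ _, fun c hcd => ?_⟩
  have hG : ∀ u ∈ Icc 0 s, ‖(pinnedChain ω₂ lam β γ).coDrift N
      ((pinnedChain ω₂ lam β γ).solMap N T_L T_R u z (pairPath wp)) (c u)‖ ≤ max C 0 * ‖c u‖ := by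
    intro u hu
    have h1 : ‖coDriftLinear ω₂ lam β γ N
        ((pinnedChain ω₂ lam β γ).solMap N T_L T_R u z (pairPath wp)) (c u)‖ ≤
        ‖coDriftLinear ω₂ lam β γ N
          ((pinnedChain ω₂ lam β γ).solMap N T_L T_R u z (pairPath wp))‖ * ‖c u‖ :=
      ContinuousLinearMap.le_opNorm _ _
    rw [coDriftLinear_apply] at h1
    exact h1.trans (mul_le_mul_of_nonneg_right ((hC u hu).trans (le_max_left _ _))
      (norm_nonneg _))
  have hcont : Continuous c := continuous_iff_continuousAt.2 fun u => (hcd u).continuousAt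
  -- time reversal `d(u) = c(s - u)` and Grönwall from `u = 0`
  set d : ℝ → PhaseSpace N := fun u => c (s - u) with hd
  have hdd : ∀ u, HasDerivAt d ((-1 : ℝ) • (pinnedChain ω₂ lam β γ).coDrift N
      ((pinnedChain ω₂ lam β γ).solMap N T_L T_R (s - u) z (pairPath wp)) (c (s - u))) u :=
    fun u => (hcd (s - u)).scomp u ((hasDerivAt_id u).const_sub s)
  have hgr := norm_le_gronwallBound_of_norm_deriv_right_le (f := d) (a := 0) (b := s)
    (δ := ‖c s‖) (K := max C 0) (ε := 0)
    (hcont.comp (continuous_const.sub continuous_id)).continuousOn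
    (fun u _ => (hdd u).hasDerivWithinAt) (by simp [hd]) fun u hu => by
      rw [norm_smul, norm_neg, norm_one, one_mul, add_zero]
      exact hG (s - u) ⟨by linarith [hu.2], by linarith [hu.1]⟩
  have hsup : ∀ u ∈ Icc 0 s, ‖c u‖ ≤ ‖c s‖ * Real.exp (max C 0 * s) := by
    intro u hu
    have h1 := hgr (s - u) ⟨by linarith [hu.2], by linarith [hu.1]⟩
    rw [gronwallBound_ε0, sub_zero] at h1
    have h2 : d (s - u) = c u := by simp [hd]
    rw [h2] at h1
    refine h1.trans (mul_le_mul_of_nonneg_left (Real.exp_le_exp.2 ?_) (norm_nonneg _))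
    exact mul_le_mul_of_nonneg_left (by linarith [hu.1]) (le_max_right _ _)
  refine ⟨hsup, fun t ht u hu => ?_⟩
  have h := Convex.norm_image_sub_le_of_norm_hasDerivWithin_le (f := c) (s := Icc 0 s)
    (fun x _ => (hcd x).hasDerivWithinAt) (fun x hx => (hG x hx).trans
      (mul_le_mul_of_nonneg_left (hsup x hx) (le_max_right _ _))) (convex_Icc 0 s) hu ht
  rwa [Real.norm_eq_abs] at h

/-! ## 3. (CSF) is a theorem; the record beneath (MC∞) is (COF) alone -/

omit hN in
/-- **(CSF) at fixed parameters — PROVED** (`ω₂ > 0`, `lam, β, γ ≥ 0`). [folklore] -/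
theorem costateSamplingFloorBody_holds : CostateSamplingFloorBody ω₂ lam β γ := by
  intro N hN T_L T_R hTL hTR s hs0 hs1 z wp η hη hframe
  have hN0 : 0 < N := by omega
  have hs : s ∈ Icc (0 : ℝ) 1 := ⟨hs0.le, hs1⟩
  obtain ⟨G, hG0, hGc⟩ := costate_bounds hω hl hβ hγ T_L T_R z wp s
  have hMc : Continuous fun u => coDriftLinear ω₂ lam β γ N
      ((pinnedChain ω₂ lam β γ).solMap N T_L T_R u z (pairPath wp)) :=
    continuous_coDriftLinear_solMap hω hl hβ hγ N T_L T_R z wp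
  -- the pathwise sampling-error coefficient
  set CE : ℝ := ampL ω₂ lam β γ T_L ^ 2 * (Real.exp (G * s) ^ 2 * (1 + s * G ^ 2)) with hCE
  -- levelwise: `F_m ≥ η/2 - 2^{-m} C_E`
  have hlevel : ∀ m : ℕ,
      η / 2 - ((2 : ℝ) ^ m)⁻¹ * CE ≤ skelGramFloor ω₂ lam β γ N T_L T_R s m z wp := by
    intro m
    refine le_skelGramFloor hN0 m z wp fun a => ?_
    set l : PhaseSpace N := ofCoordV N a with hl'
    obtain ⟨c, hcs, hcd⟩ := exists_linearODE_solution_of_continuous _ hMc s l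
    have hcd' : ∀ u, HasDerivAt c ((pinnedChain ω₂ lam β γ).coDrift N
        ((pinnedChain ω₂ lam β γ).solMap N T_L T_R u z (pairPath wp)) (c u)) u := fun u => hcd u
    have hcont : Continuous c := continuous_iff_continuousAt.2 fun u => (hcd u).continuousAt
    obtain ⟨hsup, hlip⟩ := hGc c hcd'
    rw [hcs] at hsup hlip
    -- the left-bath momentum component of the costate
    set f : ℝ → ℝ := fun u => (c u).2 ⟨0, hN0⟩ with hf
    have hfc : Continuous f := (continuous_apply _).comp (continuous_snd.comp hcont)
    have hB : ∀ t ∈ Icc 0 s, |f t| ≤ ‖l‖ * Real.exp (G * s) := fun t ht =>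
      (abs_snd_apply_le_norm N (c t) ⟨0, hN0⟩).trans (hsup t ht)
    have hL : ∀ t ∈ Icc 0 s, ∀ u ∈ Icc 0 s,
        |f t - f u| ≤ G * (‖l‖ * Real.exp (G * s)) * |t - u| := by
      intro t ht u hu
      have h1 : |f t - f u| ≤ ‖c t - c u‖ := by
        have h2 := abs_snd_apply_le_norm N (c t - c u) ⟨0, hN0⟩
        simpa only [Prod.snd_sub, Pi.sub_apply] using h2
      exact h1.trans (hlip t ht u hu)
    have hcell : ∀ k : Fin (2 ^ m), rnode m (k + 1) ≤ s →
        dualPair (ofCoordV N a) (fderiv ℝ (skelFlowMapAt ω₂ lam β γ N T_L T_R s m z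
          (pairRem m wp)) (pairSkel m wp) (basisX m (Sum.inl k))) =
            ampL ω₂ lam β γ T_L * 2 ^ m * ∫ t in rnode m k..rnode m (k + 1), f t := by
      intro k hks
      have h := dualPair_costate_skelCell_inl hω hl hβ hγ hN0 T_L T_R m z wp hs hcd' k hks
      rwa [hcs] at h
    have hgram := skelGramForm_ge_inl (ω₂ := ω₂) (lam := lam) (β := β) (γ := γ) T_L T_R m z wp
      hs0 hs1 a hfc (by positivity) hL hB hcell
    -- the frame hypothesis on this costate
    have hpc : IsPathCostate ω₂ lam β γ N T_L T_R s z wp c :=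
      ⟨hcont.continuousOn, fun u _ => hcd' u⟩
    have hfr := hframe c hpc
    rw [hcs, dualPair_eq_dotProduct, coordV_ofCoordV] at hfr
    -- the sampling error is quadratic in the direction
    have hl2 : ‖l‖ ^ 2 ≤ a ⬝ᵥ a := norm_ofCoordV_sq_le_dotProduct a
    have hErr : (‖l‖ * Real.exp (G * s)) ^ 2 + s * (G * (‖l‖ * Real.exp (G * s))) ^ 2 ≤
        (a ⬝ᵥ a) * (Real.exp (G * s) ^ 2 * (1 + s * G ^ 2)) := by
      rw [show (‖l‖ * Real.exp (G * s)) ^ 2 + s * (G * (‖l‖ * Real.exp (G * s))) ^ 2 =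
        ‖l‖ ^ 2 * (Real.exp (G * s) ^ 2 * (1 + s * G ^ 2)) by ring]
      exact mul_le_mul_of_nonneg_right hl2 (by positivity)
    have hamp2 : 0 ≤ ampL ω₂ lam β γ T_L ^ 2 := sq_nonneg _
    calc (η / 2 - ((2 : ℝ) ^ m)⁻¹ * CE) * (a ⬝ᵥ a)
        = (1 / 2) * (η * (a ⬝ᵥ a)) - ((2 : ℝ) ^ m)⁻¹ * (ampL ω₂ lam β γ T_L ^ 2 *
            ((a ⬝ᵥ a) * (Real.exp (G * s) ^ 2 * (1 + s * G ^ 2)))) := by rw [hCE]; ring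
      _ ≤ (1 / 2) * (ampL ω₂ lam β γ T_L ^ 2 * ∫ r in (0 : ℝ)..s, f r ^ 2) -
            ((2 : ℝ) ^ m)⁻¹ * (ampL ω₂ lam β γ T_L ^ 2 *
              ((‖l‖ * Real.exp (G * s)) ^ 2 + s * (G * (‖l‖ * Real.exp (G * s))) ^ 2)) := by
          gcongr
      _ = ampL ω₂ lam β γ T_L ^ 2 * ((1 / 2) * (∫ r in (0 : ℝ)..s, f r ^ 2) -
            ((2 : ℝ) ^ m)⁻¹ * ((‖l‖ * Real.exp (G * s)) ^ 2 +
              s * (G * (‖l‖ * Real.exp (G * s))) ^ 2)) := by ring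
      _ ≤ a ⬝ᵥ (skelGramPath ω₂ lam β γ N T_L T_R s m z wp *ᵥ a) := hgram
  -- the limit floor: `L = sup_m F_m⁺ ≥ η/2`
  have h2 : Tendsto (fun m : ℕ => ((2 : ℝ) ^ m)⁻¹) atTop (𝓝 0) :=
    tendsto_inv_atTop_zero.comp (tendsto_pow_atTop_atTop_of_one_lt one_lt_two)
  have hlim : Tendsto (fun m : ℕ => ENNReal.ofReal (η / 2 - ((2 : ℝ) ^ m)⁻¹ * CE)) atTop
      (𝓝 (ENNReal.ofReal (η / 2))) := by
    refine ENNReal.tendsto_ofReal ?_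
    have h := (tendsto_const_nhds (x := η / 2)).sub (h2.mul_const CE)
    simpa using h
  exact le_of_tendsto' hlim fun m =>
    (ENNReal.ofReal_le_ofReal (hlevel m)).trans (ofReal_skelGramFloor_le_limitFloor m z wp)

end Sampling

/-- **(CSF) `CostateSamplingFloor` — PROVED.** [folklore] -/
theorem costateSamplingFloor : CostateSamplingFloor := fun _ _ _ _ hω hl hβ hγ =>
  costateSamplingFloorBody_holds hω hl.le hβ.le hγ.le

/-- **(COF) ⇒ (EBF) — PROVED.** [folklore] -/
theorem energyBudgetGramFloor_of_costateObservabilityFloor (hO : CostateObservabilityFloor) :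
    EnergyBudgetGramFloor :=
  energyBudgetGramFloor_of_costateFloors costateSamplingFloor hO

/-- **(COF) ⇒ (MC∞) — PROVED**: the binder of record rests on ONE measure-free, deterministic
leaf, the quantitative costate observability inequality (COF). [folklore] -/
theorem skeletonGramLimitInverseMoments_of_costateObservabilityFloor
    (hO : CostateObservabilityFloor) : SkeletonGramLimitInverseMoments :=
  skeletonGramLimitInverseMoments_of_costateFloors costateSamplingFloor hO

end Summit.AtomisticToContinuum.FouriersLaw.Theorems.ExtensiveSnapshotIrreversibility.EnergyWindow
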